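import Literature.Analysis.Complex.EarleHamiltonBall
import Literature.MathematicalPhysics.QuantumFieldTheory.Balaban1983to89.T4HistoryLipschitzRecursion

/-!
# NE9EarleHamiltonChain — ROUTE R4's REGISTERED INTERFACE: the Carathéodory–Reiffen seminorm `crf`, its three inequalities,
# `chainLipschitz_of_holoSelfMaps`, and the END `NE9 ∧ FadingMemory` at the pure-number rate `2θ∕(1+θ)`
# (route R4 «FADING BY EARLE–HAMILTON» of `t4/ROUTES-NE9.md` v3.0.1 §L1.0 — the planner sketch
# `t4/ideate/NE9/lens1-NE9EarleHamiltonSketch.lean` sha16 bf1e3706c816fc68 (t4-ne9-idea-1 gen 3) with its FOUR `sorry`s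
# DISCHARGED by `Literature/Analysis/Complex/EarleHamiltonBall` (the published Earle–Hamilton ∕ Harris mechanism, formalised); cell `pub-balaban`, T4-DAG §2 node U3 ∕ §6 NE9; unit
# `b2b-balaban-t4-ne9-formalise-leaf-03`, generation 39; Summits-side NEW work, nothing of any import modified, nothing printed
# asserted, no named fact; the `def`s are the sketch's REGISTERED hypothesis ∕ conclusion SHAPES and the seminorm, verbatim)

HONEST FRAMING (T4-DAG PAGE 1).  Rung (B)+1 of the FINITE-VOLUME T⁴ programme — NOT infinite volume, NOT a mass gap, NOT
the Clay problem.  NE9 (`T4OutputRate.NE9` ∧ `FadingMemory`) is a cell NEW ESTIMATE, NOT PRINTED in [I] = CMP **109**, [II] =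
CMP **116**, and NOT PROVED here: the END below concludes `NE9 ∧ FadingMemory` FROM DISPLAYED BINDERS («NE9 ⇐ the named
binders»; spine PROVED 0∕9) — the θ-self-map property of the history step in future-influence coordinates (`HoloSelfMaps`, route
R4 steps EH1∕EH2∕EH4 = the INSTANCE, price P-R4-2 «σ ≤ ½ < 12∕13» with balaban-calc, NOT typed here), the factorisation of the
actual states, the LAST-COUPLING Lipschitz bound (the record's (R-1a) half, unchanged) and the read-out bound.  HONEST DEPENDENCY
(cell line, verbatim): continuum YM on T⁴ ⇐ BetaPertH ∧ nine spine estimates (0/9 proved); BetaPertH ⇐ (D1) ∧ (D4) ∧ CAP+tail;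
G-an2-4 gates asym, D1 and NE2/3/4.  `FlowStep.BetaPertH`, (B), (B^μ) do not occur.  Nothing of Bałaban's is constructed here.

WHAT (all kernel).
* §1 `crf` (the sketch's Carathéodory–Reiffen seminorm: `sSup` of `‖Dh(x)v‖` over test maps `h : D → Δ`) and its three
  REGISTERED inequalities, now theorems: `norm_le_mul_crf_ball` (‖v‖ ≤ 2R·crf, Hahn–Banach), `crf_ball_le`
  (crf ≤ ‖v‖∕(R − ‖x‖), Cauchy — sharp constant), `crf_image_le` (Earle–Hamilton ∕ Harris: factor `2θ∕(1+θ)` through a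
  holomorphic map `ball 0 R₁ → closedBall 0 (θR₂)`) — `csSup` algebra over `Literature.Analysis.Complex.EarleHamilton` (U)∕(L)∕(EH)
  (`crfSet_nonempty`, `bddAbove_crfSet_ball`, `le_crf_ball`).
* §2 `evol` (composites `S (K−1) ∘ ⋯ ∘ S i`) with the sketch's four lemmas, the hypothesis ∕ conclusion SHAPES `HoloSelfMaps`,
  `ChainLipschitz`, and THE REGISTERED KERNEL STATEMENT **`chainLipschitz_of_holoSelfMaps`** — now a theorem
  (`EarleHamilton.norm_sub_le_of_holoChain` on `T m := evol (S·g) i (i+m)`; the case `K ≤ i` is `2∕(1−θ) ≥ 1`).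
* §3 the sketch's END, verbatim and unchanged (it was already sorry-free there): `ne9_and_fadingMemory_of_chainLipschitz`
  (pure algebra: telescoping over the coupling index + `prodModuli_const` + `fadingMemory_geometric`) and
  **`ne9_and_fadingMemory_of_holoSelfMaps`** — NOW UNCONDITIONAL ON ANY `sorry`: `NE9 E W κ (prodModuli (cR·(2∕(1−θ))·ℓ) (fun _
  ↦ 2θ∕(1+θ))) ∧ FadingMemory (cR·(2∕(1−θ))·ℓ ∕ (2θ∕(1+θ))) (2θ∕(1+θ)) (…)`; `rate_lt_one`; the print-letter `example`
  (θ = 1∕13 + 1∕2 ⇒ rate 30∕41 — the planner's READING of [II] pp. 8, 21, NOT certified, asserted nowhere).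
SIGNATURES: §1–§3 are the sketch's declarations with TYPES VERBATIM (namespace `NE9Lens1EH` ↦ this module's); hypotheses
the proofs do not use are kept (flagged by `_`-free binders only where Lean's linter allows — see `crf_image_le`, whose `hθ0`
IS used, and `chainLipschitz_of_holoSelfMaps`).
DISGUISE TEST: no inequality of the series; not NE9 for Bałaban's terms; no Bałaban object; 0 sorry; no named fact.  What
route R4 still needs: EH1∕EH2∕EH4 (the instance on `𝔜 × ℓ^∞(ℕ × W; Pot^ℂ)`, room N2♭ — leaf-10 lineage per §L1.0 HAND-OFF)
and P2 (Fréchet-from-line holomorphy of the table map); W1 = (D1), (R-1a), TermSize, N3 untouched.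

References: [EH1970] C. J. Earle, R. S. Hamilton, Proc. Sympos. Pure Math. XVI (1970) 61–65; [FV1980] T. Franzoni,
E. Vesentini, North-Holland Math. Studies 40 (1980), Lemma IV.2.1, Lemma V.5.1, Thm V.5.2; [Chae1985] S. B. Chae, Holomorphy
and Calculus in Normed Spaces (1985), Thm 13.18; [Balaban1988RG2Cluster] T. Bałaban, CMP **116** (1988) 1–22, pp. 8, 9
(1.36), 11 (Lemma 2), 20 (2.38), 21 (TYPES ∕ loci only; nothing asserted).
-/

noncomputable section

namespace Summit.QuantumFields.BalabanUV.T4Continuum.NE9EarleHamiltonChain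

open Metric Set
open scoped BigOperators
open Literature.Analysis.Complex.EarleHamilton
open Literature.MathematicalPhysics.QuantumFieldTheory.Balaban1983to89.T4OutputRate
open Literature.MathematicalPhysics.QuantumFieldTheory.Balaban1983to89.T4HistoryLipschitzRecursion
  (prodModuli prodModuli_const fadingMemory_geometric)

variable {𝔛 : Type*} [NormedAddCommGroup 𝔛] [NormedSpace ℂ 𝔛]

/-! ## §1 The Carathéodory–Reiffen seminorm and its three registered inequalities (now theorems) -/

/-- The Carathéodory–Reiffen (infinitesimal Carathéodory) seminorm of the domain `D` at the point `x` in the direction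
`v`: the supremum of `‖Dh(x)v‖` over holomorphic `h : D → Δ` (unit disc) — the planner sketch's `NE9Lens1EH.crf`, verbatim.
[FV1980 Ch. V; Chae1985 §13.]  Only its three inequalities below are used. [folklore] -/
def crf (D : Set 𝔛) (x v : 𝔛) : ℝ :=
  sSup ((fun h : 𝔛 → ℂ => ‖(fderiv ℂ h x) v‖) ''
    {h : 𝔛 → ℂ | DifferentiableOn ℂ h D ∧ MapsTo h D (ball (0 : ℂ) 1)})

/-- The set of test-map values is nonempty (the test map `0`). [folklore] -/
theorem crfSet_nonempty (D : Set 𝔛) (x v : 𝔛) :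
    ((fun h : 𝔛 → ℂ => ‖(fderiv ℂ h x) v‖) ''
      {h : 𝔛 → ℂ | DifferentiableOn ℂ h D ∧ MapsTo h D (ball (0 : ℂ) 1)}).Nonempty :=
  ⟨_, ⟨fun _ => 0, ⟨differentiableOn_const _, fun u _ => by simp⟩, rfl⟩⟩

/-- On a ball, at an interior point, the set of test-map values is bounded above (by the Cauchy bound
`EarleHamilton.norm_fderiv_le_div_of_mapsTo_ball`). [folklore] -/
theorem bddAbove_crfSet_ball {R : ℝ} {x : 𝔛} (hx : x ∈ ball (0 : 𝔛) R) (v : 𝔛) :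
    BddAbove ((fun h : 𝔛 → ℂ => ‖(fderiv ℂ h x) v‖) ''
      {h : 𝔛 → ℂ | DifferentiableOn ℂ h (ball (0 : 𝔛) R) ∧ MapsTo h (ball (0 : 𝔛) R) (ball (0 : ℂ) 1)}) := by
  refine ⟨‖v‖ / (R - ‖x‖), ?_⟩
  rintro _ ⟨h, ⟨hd, hm⟩, rfl⟩
  exact norm_fderiv_le_div_of_mapsTo_ball hd hm hx v

/-- Every test map of the ball is dominated by `crf` at an interior point. [folklore] -/
theorem le_crf_ball {R : ℝ} {x : 𝔛} (hx : x ∈ ball (0 : 𝔛) R) (v : 𝔛) {h : 𝔛 → ℂ}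
    (hd : DifferentiableOn ℂ h (ball (0 : 𝔛) R)) (hm : MapsTo h (ball (0 : 𝔛) R) (ball (0 : ℂ) 1)) :
    ‖(fderiv ℂ h x) v‖ ≤ crf (ball (0 : 𝔛) R) x v :=
  le_csSup (bddAbove_crfSet_ball hx v) ⟨h, ⟨hd, hm⟩, rfl⟩

/-- LOWER COMPARISON on a ball [FV1980 Lemma IV.2.1, due to Earle–Hamilton; Hahn–Banach] — the sketch's registered
`norm_le_mul_crf_ball`, now a theorem (`EarleHamilton.norm_le_of_forall_testMap` with `c := crf`). [folklore] -/
theorem norm_le_mul_crf_ball {R : ℝ} (hR : 0 < R) {x : 𝔛} (hx : x ∈ ball (0 : 𝔛) R) (v : 𝔛) :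
    ‖v‖ ≤ 2 * R * crf (ball (0 : 𝔛) R) x v :=
  norm_le_of_forall_testMap hR hx v fun _ hd hm => le_crf_ball hx v hd hm

/-- UPPER COMPARISON on a ball [Cauchy estimate on complex lines, sharp constant] — the sketch's registered `crf_ball_le`,
now a theorem. [folklore] -/
theorem crf_ball_le {R : ℝ} {x : 𝔛} (hx : x ∈ ball (0 : 𝔛) R) (v : 𝔛) :
    crf (ball (0 : 𝔛) R) x v ≤ ‖v‖ / (R - ‖x‖) := by
  refine csSup_le (crfSet_nonempty _ _ _) ?_
  rintro _ ⟨h, ⟨hd, hm⟩, rfl⟩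
  exact norm_fderiv_le_div_of_mapsTo_ball hd hm hx v

/-- EARLE–HAMILTON INFINITESIMAL CONTRACTION [FV1980 Lemma V.5.1; Chae1985 Thm 13.18 (Harris)], read for a holomorphic map
of `ball 0 R₁ ⊆ 𝔛` into `closedBall 0 (θR₂) ⊆ 𝔜`, `0 < θ < 1`:
`crf_{B(0,R₂)}(f x; Df(x)v) ≤ (2θ∕(1+θ)) · crf_{B(0,R₁)}(x; v)` — the sketch's registered `crf_image_le`, now a theorem
(`EarleHamilton.forall_testMap_image_le` with `c := crf`). [folklore] -/
theorem crf_image_le {𝔜 : Type*} [NormedAddCommGroup 𝔜] [NormedSpace ℂ 𝔜] {R₁ R₂ θ : ℝ} (hθ0 : 0 < θ) (hθ1 : θ < 1)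
    {f : 𝔛 → 𝔜} (hf : DifferentiableOn ℂ f (ball (0 : 𝔛) R₁))
    (hmaps : MapsTo f (ball (0 : 𝔛) R₁) (closedBall (0 : 𝔜) (θ * R₂)))
    {x : 𝔛} (hx : x ∈ ball (0 : 𝔛) R₁) (v : 𝔛) :
    crf (ball (0 : 𝔜) R₂) (f x) (fderiv ℂ f x v) ≤ 2 * θ / (1 + θ) * crf (ball (0 : 𝔛) R₁) x v := by
  refine csSup_le (crfSet_nonempty _ _ _) ?_
  rintro _ ⟨h, ⟨hd, hm⟩, rfl⟩
  exact forall_testMap_image_le hθ0 hθ1 hf hmaps hx v (fun _ hg hgm => le_crf_ball hx v hg hgm) hd hm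

/-! ## §2 Composites of holomorphic θ-self-maps of one ball: the registered kernel statement, now a theorem -/

/-- The composite «evolve from time `i` to time `K`»: `evol S i K = S (K−1) ∘ ⋯ ∘ S i` (identity if `K ≤ i`) — the sketch's
`evol`, verbatim. [folklore] -/
def evol (S : ℕ → 𝔛 → 𝔛) (i : ℕ) : ℕ → 𝔛 → 𝔛
  | 0 => id
  | K + 1 => if i ≤ K then S K ∘ evol S i K else id

omit [NormedAddCommGroup 𝔛] [NormedSpace ℂ 𝔛] in
/-- `evol S i K = id` for `K ≤ i`. [folklore] -/
theorem evol_of_le {S : ℕ → 𝔛 → 𝔛} {i K : ℕ} (h : K ≤ i) : evol S i K = id := by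
  induction K with
  | zero => rfl
  | succ K _ =>
    have hK : ¬ i ≤ K := by omega
    simp [evol, hK]

omit [NormedAddCommGroup 𝔛] [NormedSpace ℂ 𝔛] in
/-- `evol S i i x = x`. [folklore] -/
theorem evol_self_apply (S : ℕ → 𝔛 → 𝔛) (i : ℕ) (x : 𝔛) : evol S i i x = x := by
  rw [evol_of_le le_rfl]; rfl

omit [NormedAddCommGroup 𝔛] [NormedSpace ℂ 𝔛] in
/-- One more step: `evol S i (K+1) x = S K (evol S i K x)` for `i ≤ K`. [folklore] -/
theorem evol_succ_apply {S : ℕ → 𝔛 → 𝔛} {i K : ℕ} (h : i ≤ K) (x : 𝔛) :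
    evol S i (K + 1) x = S K (evol S i K x) := by
  simp [evol, h]

omit [NormedAddCommGroup 𝔛] [NormedSpace ℂ 𝔛] in
/-- Splitting off the first step: `evol S i K = evol S (i+1) K ∘ S i` for `i < K`. [folklore] -/
theorem evol_split {S : ℕ → 𝔛 → 𝔛} {i : ℕ} (x : 𝔛) :
    ∀ K, i + 1 ≤ K → evol S i K x = evol S (i + 1) K (S i x) := by
  refine Nat.le_induction ?_ ?_
  · rw [evol_succ_apply le_rfl, evol_self_apply, evol_self_apply]
  · intro K hK ih
    rw [evol_succ_apply (by omega), evol_succ_apply hK, ih]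

/-- HYPOTHESIS SHAPE (the instance's burden, route R4 steps EH1–EH2): uniformly in the step `k` and the coupling sequence
`g ∈ W`, the step map `S k g` is (Fréchet-)holomorphic on the ball `B(0,r)` of ONE complex Banach space and maps it into the
strictly smaller closed ball `B̄(0,θr)` — the sketch's `HoloSelfMaps`, verbatim (a hypothesis SHAPE, asserted of nothing). [folklore] -/
def HoloSelfMaps (S : ℕ → (ℕ → ℝ) → 𝔛 → 𝔛) (W : Set (ℕ → ℝ)) (r θ : ℝ) : Prop :=
  ∀ k, ∀ g ∈ W, DifferentiableOn ℂ (S k g) (ball (0 : 𝔛) r) ∧ MapsTo (S k g) (ball (0 : 𝔛) r) (closedBall 0 (θ * r))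

/-- CONCLUSION SHAPE of the kernel: every composite `evol (S · g) i K` is Lipschitz on the inner ball `B̄(0,θr)` with
constant `Cc · k^{K−i}` — the sketch's `ChainLipschitz`, verbatim (a conclusion SHAPE, asserted of nothing). [folklore] -/
def ChainLipschitz (S : ℕ → (ℕ → ℝ) → 𝔛 → 𝔛) (W : Set (ℕ → ℝ)) (r θ Cc k : ℝ) : Prop :=
  ∀ g ∈ W, ∀ i K : ℕ, ∀ x ∈ closedBall (0 : 𝔛) (θ * r), ∀ y ∈ closedBall (0 : 𝔛) (θ * r),
    ‖evol (fun j => S j g) i K x - evol (fun j => S j g) i K y‖ ≤ Cc * k ^ (K - i) * ‖x - y‖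

/-- **THE KERNEL (Earle–Hamilton chain estimate) — the sketch's registered `chainLipschitz_of_holoSelfMaps`, NOW A THEOREM**:
holomorphic θ-self-maps of one ball compose to contractions on the inner ball with ratio `2θ∕(1+θ) < 1` and prefactor
`2∕(1−θ)`.  For `i < K` this is `EarleHamilton.norm_sub_le_of_holoChain` for the chain `T m := evol (S·g) i (i+m)`,
`f m := S (i+m) g`; for `K ≤ i` the composite is the identity and `2∕(1−θ) ≥ 1`.  (`hθ0` enters through `crf_image_le`'s
Harris parameter `s < (1−θ)∕(2θ)`.) [EH1970; FV1980 Thm V.5.2 (proof); folklore] -/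
theorem chainLipschitz_of_holoSelfMaps {S : ℕ → (ℕ → ℝ) → 𝔛 → 𝔛} {W : Set (ℕ → ℝ)} {r θ : ℝ}
    (hr : 0 < r) (hθ0 : 0 < θ) (hθ1 : θ < 1) (hS : HoloSelfMaps S W r θ) :
    ChainLipschitz S W r θ (2 / (1 - θ)) (2 * θ / (1 + θ)) := by
  intro g hg i K x hx y hy
  rcases le_or_gt K i with hKi | hiK
  · rw [evol_of_le hKi, Nat.sub_eq_zero_of_le hKi, pow_zero, mul_one, id, id]
    have h1 : (1 : ℝ) ≤ 2 / (1 - θ) := by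
      rw [le_div_iff₀ (by linarith)]; linarith
    nlinarith [norm_nonneg (x - y)]
  · obtain ⟨n, rfl⟩ := Nat.exists_eq_add_of_lt hiK
    have key := norm_sub_le_of_holoChain hr hθ0 hθ1 (f := fun m => S (i + m) g)
      (T := fun m => evol (fun j => S j g) i (i + m)) (fun m => (hS (i + m) g hg).1) (fun m => (hS (i + m) g hg).2)
      (evol_of_le le_rfl) (fun m => funext fun z => evol_succ_apply (Nat.le_add_right i m) z) (n + 1) hx hy
    have hsub : i + n + 1 - i = n + 1 := by omega
    rw [hsub]
    exact key

/-! ## §3 The END: telescoping over the coupling index (the sketch's END, verbatim; now sorry-free throughout) -/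

omit [NormedSpace ℂ 𝔛] in
/-- END OF ROUTE R4 (algebraic half, kernel-checked; valid in ANY real normed group `𝔛`; the sketch's
`ne9_and_fadingMemory_of_chainLipschitz`, verbatim): holomorphy is not even mentioned — only the chain Lipschitz estimate on
the inner ball, the θ-self-map property, the factorisation of the actual states `emb (k+1) g = S k g (emb k g)` through a
common initial state, the LAST-COUPLING Lipschitz bound of the step at the actual state (the tree's
`T4HistoryLipschitzOuter.LastCouplingLipschitz` shape, constant `lam k ≤ ℓ`), and a READ-OUT bound of the scale-`k` term
difference by the state distance (constant `cR`).  Conclusion: `NE9` with the geometric history moduli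
`prodModuli (cR·Cc·ℓ) (fun _ => k)` and `FadingMemory` at rate `k`. [folklore] -/
theorem ne9_and_fadingMemory_of_chainLipschitz {C : Carriers} {Bg : Type} (E : Functional C Bg) (W : Set (ℕ → ℝ))
    (S : ℕ → (ℕ → ℝ) → 𝔛 → 𝔛) (emb : ℕ → (ℕ → ℝ) → 𝔛) {κ r θ Cc k ℓ cR : ℝ} {lam : ℕ → ℝ}
    (hr : 0 < r) (hθ1 : θ < 1) (hCc : 0 ≤ Cc) (hk : 0 < k) (hℓ : 0 ≤ ℓ) (hcR : 0 ≤ cR)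
    (hmaps : ∀ j, ∀ g ∈ W, MapsTo (S j g) (ball (0 : 𝔛) r) (closedBall 0 (θ * r)))
    (hchain : ChainLipschitz S W r θ Cc k)
    (hfac : ∀ j, ∀ g ∈ W, emb (j + 1) g = S j g (emb j g))
    (h0 : ∀ g ∈ W, ∀ g' ∈ W, emb 0 g = emb 0 g')
    (h0in : ∀ g ∈ W, emb 0 g ∈ closedBall (0 : 𝔛) (θ * r))
    (hlast : ∀ j, ∀ g ∈ W, ∀ g' ∈ W, ‖S j g (emb j g) - S j g' (emb j g)‖ ≤ lam j * |g j - g' j|)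
    (hlam : ∀ j, lam j ≤ ℓ)
    (hread : ∀ g ∈ W, ∀ g' ∈ W, ∀ (U : Bg) (X : C.Dom),
      |E g U X - E g' U X| ≤ Real.exp (-(κ * C.d X)) * (cR * ‖emb (C.scale X) g - emb (C.scale X) g'‖)) :
    NE9 E W κ (prodModuli (cR * Cc * ℓ) fun _ => k) ∧
      FadingMemory (cR * Cc * ℓ / k) k (prodModuli (cR * Cc * ℓ) fun _ => k) := by
  -- the inner closed ball sits inside the open ball
  have hsub : closedBall (0 : 𝔛) (θ * r) ⊆ ball 0 r := closedBall_subset_ball (by nlinarith)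
  -- actual states stay in the inner ball
  have hmem : ∀ g ∈ W, ∀ K, emb K g ∈ closedBall (0 : 𝔛) (θ * r) := by
    intro g hg K
    induction K with
    | zero => exact h0in g hg
    | succ K ih => rw [hfac K g hg]; exact hmaps K g hg (hsub ih)
  -- actual states are composites of the own-coupling steps
  have hev : ∀ g ∈ W, ∀ i K, i ≤ K → emb K g = evol (fun j => S j g) i K (emb i g) := by
    intro g hg i
    refine Nat.le_induction ?_ ?_
    · rw [evol_self_apply]
    · intro K hK ih
      rw [hfac K g hg, ih, evol_succ_apply hK]
  -- KEY: telescoping over the coupling index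
  have hkey : ∀ g ∈ W, ∀ g' ∈ W, ∀ K,
      ‖emb K g - emb K g'‖ ≤ ∑ i ∈ Finset.range K, Cc * k ^ (K - 1 - i) * (ℓ * |g i - g' i|) := by
    intro g hg g' hg' K
    set a : ℕ → 𝔛 := fun i => evol (fun j => S j g') i K (emb i g) with ha
    have haK : a K = emb K g := by simp only [ha]; exact evol_self_apply _ _ _
    have ha0 : a 0 = emb K g' := by
      simp only [ha]; rw [h0 g hg g' hg', ← hev g' hg' 0 K (Nat.zero_le _)]
    have htel : emb K g - emb K g' = ∑ i ∈ Finset.range K, (a (i + 1) - a i) := by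
      rw [Finset.sum_range_sub, haK, ha0]
    have hterm : ∀ i ∈ Finset.range K, ‖a (i + 1) - a i‖ ≤ Cc * k ^ (K - 1 - i) * (ℓ * |g i - g' i|) := by
      intro i hi
      have hiK : i < K := Finset.mem_range.mp hi
      have he : emb i g ∈ closedBall (0 : 𝔛) (θ * r) := hmem g hg i
      have h1 : a i = evol (fun j => S j g') (i + 1) K (S i g' (emb i g)) := by
        simp only [ha]; exact evol_split _ K hiK
      have h2 : a (i + 1) = evol (fun j => S j g') (i + 1) K (S i g (emb i g)) := by
        simp only [ha]; rw [hfac i g hg]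
      have hx : S i g (emb i g) ∈ closedBall (0 : 𝔛) (θ * r) := hmaps i g hg (hsub he)
      have hy : S i g' (emb i g) ∈ closedBall (0 : 𝔛) (θ * r) := hmaps i g' hg' (hsub he)
      have hnn : 0 ≤ Cc * k ^ (K - (i + 1)) := mul_nonneg hCc (pow_nonneg hk.le _)
      rw [h1, h2]
      calc ‖evol (fun j => S j g') (i + 1) K (S i g (emb i g)) - evol (fun j => S j g') (i + 1) K (S i g' (emb i g))‖
          ≤ Cc * k ^ (K - (i + 1)) * ‖S i g (emb i g) - S i g' (emb i g)‖ := hchain g' hg' (i + 1) K _ hx _ hy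
        _ ≤ Cc * k ^ (K - (i + 1)) * (lam i * |g i - g' i|) :=
          mul_le_mul_of_nonneg_left (hlast i g hg g' hg') hnn
        _ ≤ Cc * k ^ (K - (i + 1)) * (ℓ * |g i - g' i|) :=
          mul_le_mul_of_nonneg_left (mul_le_mul_of_nonneg_right (hlam i) (abs_nonneg _)) hnn
        _ = Cc * k ^ (K - 1 - i) * (ℓ * |g i - g' i|) := by
          rw [show K - (i + 1) = K - 1 - i by omega]
    calc ‖emb K g - emb K g'‖ = ‖∑ i ∈ Finset.range K, (a (i + 1) - a i)‖ := by rw [htel]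
      _ ≤ ∑ i ∈ Finset.range K, ‖a (i + 1) - a i‖ := norm_sum_le _ _
      _ ≤ ∑ i ∈ Finset.range K, Cc * k ^ (K - 1 - i) * (ℓ * |g i - g' i|) := Finset.sum_le_sum hterm
  refine ⟨?_, fadingMemory_geometric (mul_nonneg (mul_nonneg hcR hCc) hℓ) hk⟩
  intro g hg g' hg' U X
  calc |E g U X - E g' U X|
      ≤ Real.exp (-(κ * C.d X)) * (cR * ‖emb (C.scale X) g - emb (C.scale X) g'‖) := hread g hg g' hg' U X
    _ ≤ Real.exp (-(κ * C.d X)) *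
          (cR * ∑ i ∈ Finset.range (C.scale X), Cc * k ^ (C.scale X - 1 - i) * (ℓ * |g i - g' i|)) :=
        mul_le_mul_of_nonneg_left (mul_le_mul_of_nonneg_left (hkey g hg g' hg' _) hcR) (Real.exp_pos _).le
    _ = Real.exp (-(κ * C.d X)) *
          ∑ i ∈ Finset.range (C.scale X), prodModuli (cR * Cc * ℓ) (fun _ => k) (C.scale X) i * |g i - g' i| := by
        congr 1
        rw [Finset.mul_sum]
        refine Finset.sum_congr rfl fun i hi => ?_
        rw [prodModuli_const, if_pos (Finset.mem_range.mp hi)]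
        ring

/-- **END OF ROUTE R4 WITH THE KERNEL — the sketch's `ne9_and_fadingMemory_of_holoSelfMaps`, NOW UNCONDITIONAL ON ANY
`sorry`**: holomorphic θ-self-maps of ONE ball, uniformly in the step and the couplings, plus the structural identities and
the last-coupling ∕ read-out bounds, give `NE9 ∧ FadingMemory` at the PURE-NUMBER rate `2θ∕(1+θ)` with constant
`cR · (2∕(1−θ)) · ℓ` — no Lipschitz constant of the step map, no `τ̄`, no room margin beyond `θ < 1`.  «NE9 ⇐ the named
binders»: `hS` (the INSTANCE, route R4 EH1∕EH2∕EH4 — NOT typed in the tree), `hfac`∕`h0`∕`h0in`, `hlast` (= (R-1a)), `hread`.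
[folklore] -/
theorem ne9_and_fadingMemory_of_holoSelfMaps {C : Carriers} {Bg : Type} (E : Functional C Bg) (W : Set (ℕ → ℝ))
    (S : ℕ → (ℕ → ℝ) → 𝔛 → 𝔛) (emb : ℕ → (ℕ → ℝ) → 𝔛) {κ r θ ℓ cR : ℝ} {lam : ℕ → ℝ}
    (hr : 0 < r) (hθ0 : 0 < θ) (hθ1 : θ < 1) (hℓ : 0 ≤ ℓ) (hcR : 0 ≤ cR)
    (hS : HoloSelfMaps S W r θ)
    (hfac : ∀ j, ∀ g ∈ W, emb (j + 1) g = S j g (emb j g))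
    (h0 : ∀ g ∈ W, ∀ g' ∈ W, emb 0 g = emb 0 g')
    (h0in : ∀ g ∈ W, emb 0 g ∈ closedBall (0 : 𝔛) (θ * r))
    (hlast : ∀ j, ∀ g ∈ W, ∀ g' ∈ W, ‖S j g (emb j g) - S j g' (emb j g)‖ ≤ lam j * |g j - g' j|)
    (hlam : ∀ j, lam j ≤ ℓ)
    (hread : ∀ g ∈ W, ∀ g' ∈ W, ∀ (U : Bg) (X : C.Dom),
      |E g U X - E g' U X| ≤ Real.exp (-(κ * C.d X)) * (cR * ‖emb (C.scale X) g - emb (C.scale X) g'‖)) :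
    NE9 E W κ (prodModuli (cR * (2 / (1 - θ)) * ℓ) fun _ => 2 * θ / (1 + θ)) ∧
      FadingMemory (cR * (2 / (1 - θ)) * ℓ / (2 * θ / (1 + θ))) (2 * θ / (1 + θ))
        (prodModuli (cR * (2 / (1 - θ)) * ℓ) fun _ => 2 * θ / (1 + θ)) :=
  ne9_and_fadingMemory_of_chainLipschitz E W S emb hr hθ1 (div_nonneg zero_le_two (by linarith))
    (div_pos (by linarith) (by linarith)) hℓ hcR (fun j g hg => (hS j g hg).2)
    (chainLipschitz_of_holoSelfMaps hr hθ0 hθ1 hS) hfac h0 h0in hlast hlam hread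

/-- SANITY (the rate is a pure number `< 1` as soon as `θ < 1`). [folklore] -/
theorem rate_lt_one {θ : ℝ} (hθ0 : 0 < θ) (hθ1 : θ < 1) : 2 * θ / (1 + θ) < 1 := by
  rw [div_lt_one (by linarith)]; linarith

/-- SANITY (print-letter arithmetic of ROUTES-NE9 v3 §L1.0: `θ = 1∕L + 1∕2` at `L = 13` gives rate `30∕41 < 3∕4` — the
planner's READING of [II] p. 8 «2(6L)⁴» and p. 21 «O(1)C₃ε₁ ≤ ½E₀», NOT certified, asserted nowhere). -/
example : 2 * ((1 : ℝ) / 13 + 1 / 2) / (1 + (1 / 13 + 1 / 2)) = 30 / 41 := by norm_num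

end Summit.QuantumFields.BalabanUV.T4Continuum.NE9EarleHamiltonChain

end
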